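import Literature.MathematicalPhysics.QuantumManyBody.BosonicFloor
import Literature.MathematicalPhysics.QuantumManyBody.PeriodicClusteringFromKyFanGap
import HarnessLib

/-!
# The half-swapped two-copy quadratic form: measurability, parallelogram law, regularised modulus

Topic `Literature/MathematicalPhysics/QuantumManyBody` (companion of `BosonicFloor.lean` and
`BosonicFloorSymmetrisation.lean`; wanted by the crux `TorusHalfSwapOverlap` of
`AtomisticToContinuum/BoseEinsteinCondensation`, route `BECSwapNoCatastrophe`, line `birth`:
"the infimum of the `F`-invariant half-swapped form over `F`-symmetric states is its absolute
infimum", the near-minimiser form of the Perron–Frobenius symmetry of a stoquastic ground state,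
proved without Perron–Frobenius exactly as "bosonic = absolute ground-state energy"
[LSSY2005, Ch. 2]).

Two copies of the periodic `M`-particle torus gas live on `(ℝ³)^M × (ℝ³)^M ∋ Z = (X, Y)`; the
half-swapped two-copy quadratic form is `q(Θ) = ∫ (|∇_X Θ|² + |∇_Y Θ|² + W |Θ|²) dμ` with the
sliced kinetic densities `kineticDensity (fun X => Θ (X, Y)) X`,
`kineticDensity (fun Y => Θ (X, Y)) Y` and a measurable weight `W ≥ 0` (hard cores `⊤` allowed;
for the half-swapped Hamiltonian `W = V(X̂) + V(Ŷ) + ½∑ⱼ [v(x₀-xⱼ) + v(y₀-yⱼ) + v(y₀-xⱼ) +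
v(x₀-yⱼ)]`, `measurable_halfSwapWeight`). Throughout, `q` is an abstract functional `E` pinned
down by the hypothesis `hE : ∀ Θ, E Θ = ∫⁻ …`, so that the statements stay short and every
instantiation is definitional. This file provides the pointwise/integral tools:

* `measurable_integrand`, `measurable_halfSwapWeight` — joint measurability of the density
  (sliced gradients via `measurable_fderiv_apply_const_with_param`) and of the half-swapped weight;
* `form_add_add_sub`, `lintegral_nnnorm_add_sub` — the PARALLELOGRAM LAW
  `q(Θ+Φ) + q(Θ-Φ) = 2(q Θ + q Φ)` and its `L²` analogue (slice-wise
  `kineticDensity_fun_add_add_sub` of `PeriodicClusteringFromKyFanGap.lean`); `form_const_mul` —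
  scaling `q(cΘ) = c² q(Θ)`;
* the regularised modulus `√(ε² + |g|²) − ε` of ONE function (the one-element case of
  `BosonicFloorSymmetrisation.lean`): `contDiff_ofReal_sqrtReg`, the diamagnetic inequality
  `nnnorm_fderiv_ofReal_sqrtReg_one_sq_le` / `kineticDensity_sqrtReg_le` [LiebLoss2001, Thm. 7.8],
  `form_sqrtReg_le` (`q(√(ε²+|g|²) − ε) ≤ q(g)`, infinite weights allowed), and
  `tendsto_lintegral_nnnorm_sqrtReg_sq` (its `L²` norm tends to `‖g‖²` as `ε = 1/(m+1) → 0`,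
  dominated convergence).

Not here: the infimum argument itself (symmetric/antisymmetric branches), which lives with the
crux in `Summits/AtomisticToContinuum/BoseEinsteinCondensation/Theorems/`.

## References

* [LiebLoss2001] E. H. Lieb, M. Loss, *Analysis*, 2nd ed., AMS 2001, Thm. 7.8 (convexity
  inequality for gradients).
* [LSSY2005] E. H. Lieb, R. Seiringer, J. P. Solovej, J. Yngvason, *The Mathematics of the Bose
  Gas and its Condensation*, Birkhäuser 2005, Ch. 2 (bosonic = absolute ground-state energy).
-/

noncomputable section

open _root_.MeasureTheory Filter _root_.Topology
open scoped ENNReal NNReal BigOperators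

namespace Literature.MathematicalPhysics.QuantumManyBody.BoseGas.HalfSwapForm


variable {M : ℕ}

/-! #### Measurability of the two-copy energy density and of the half-swapped weight -/

/-- The periodised potential of a measurable profile is measurable (copy of the private lemma of
`BosonicFloor.lean`). [folklore] -/
private theorem measurable_periodizedPotential {v : ℝ → ℝ≥0∞} (hv : Measurable v) (L : ℝ) :
    Measurable (periodizedPotential v L) := by
  show Measurable fun x => ∑' n : Fin 3 → ℤ, v ‖x - latticeVec L n‖
  exact Measurable.tsum fun n => hv.comp (measurable_id.sub_const _).norm

/-- The periodic pair interaction of a measurable profile is measurable (copy of the private lemma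
of `BosonicFloor.lean`). [folklore] -/
private theorem measurable_periodicInteraction {v : ℝ → ℝ≥0∞} (hv : Measurable v) (L : ℝ) :
    Measurable fun X : Config M => periodicInteraction v L X := by
  unfold periodicInteraction
  refine Finset.measurable_sum _ fun i _ => Finset.measurable_sum _ fun j _ => ?_
  exact (measurable_periodizedPotential hv L).comp
    ((measurable_pi_apply i).sub (measurable_pi_apply j))

/-- **Measurability of the half-swapped weight** `V(X̂) + V(Ŷ) + ½∑ⱼ [v(x₀-xⱼ) + v(y₀-yⱼ) +
v(y₀-xⱼ) + v(x₀-yⱼ)]` of two copies of `n + 1` particles, for a measurable profile `v`.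
[folklore] -/
theorem measurable_halfSwapWeight {v : ℝ → ℝ≥0∞} (hv : Measurable v) (n : ℕ) (L : ℝ) :
    Measurable fun Z : Config (n + 1) × Config (n + 1) =>
      periodicInteraction v L (Fin.tail Z.1) + periodicInteraction v L (Fin.tail Z.2) +
        ∑ j : Fin n, (2 : ENNReal)⁻¹ * (periodizedPotential v L (Z.1 0 - Z.1 j.succ) +
          periodizedPotential v L (Z.2 0 - Z.2 j.succ) +
          periodizedPotential v L (Z.2 0 - Z.1 j.succ) +
          periodizedPotential v L (Z.1 0 - Z.2 j.succ)) := by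
  have hpp : Measurable (periodizedPotential v L) := measurable_periodizedPotential hv L
  have hpI : Measurable fun X : Config n => periodicInteraction v L X :=
    measurable_periodicInteraction hv L
  have ht1 : Measurable fun Z : Config (n + 1) × Config (n + 1) => Fin.tail Z.1 :=
    measurable_pi_lambda _ fun i => (measurable_pi_apply _).comp measurable_fst
  have ht2 : Measurable fun Z : Config (n + 1) × Config (n + 1) => Fin.tail Z.2 :=
    measurable_pi_lambda _ fun i => (measurable_pi_apply _).comp measurable_snd
  have h1 : ∀ i : Fin (n + 1), Measurable fun Z : Config (n + 1) × Config (n + 1) => Z.1 i :=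
    fun i => (measurable_pi_apply i).comp measurable_fst
  have h2 : ∀ i : Fin (n + 1), Measurable fun Z : Config (n + 1) × Config (n + 1) => Z.2 i :=
    fun i => (measurable_pi_apply i).comp measurable_snd
  refine ((hpI.comp ht1).fun_add (hpI.comp ht2)).fun_add (Finset.measurable_sum _ fun j _ => ?_)
  exact ((((hpp.comp ((h1 0).sub (h1 _))).fun_add (hpp.comp ((h2 0).sub (h2 _)))).fun_add
    (hpp.comp ((h2 0).sub (h1 _)))).fun_add (hpp.comp ((h1 0).sub (h2 _)))).const_mul _

/-- **Joint measurability of the half-swapped two-copy energy density** `|∇_X f|² + |∇_Y f|² +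
W |f|²` of a continuous `f` on `(ℝ³)^M × (ℝ³)^M`, for a measurable weight `W` (the sliced partial
gradients are jointly measurable by `measurable_fderiv_apply_const_with_param`). [folklore] -/
theorem measurable_integrand {W : Config M × Config M → ℝ≥0∞} (hW : Measurable W)
    {f : Config M × Config M → ℂ} (hf : Continuous f) :
    Measurable fun Z : Config M × Config M =>
      kineticDensity (fun X => f (X, Z.2)) Z.1 + kineticDensity (fun Y => f (Z.1, Y)) Z.2 +
        W Z * ((‖f Z‖₊ : ℝ≥0∞)) ^ 2 := by
  have hX : Continuous (Function.uncurry fun (Y : Config M) (X : Config M) => f (X, Y)) :=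
    hf.comp continuous_swap
  have hY : Continuous (Function.uncurry fun (X : Config M) (Y : Config M) => f (X, Y)) := hf
  unfold kineticDensity
  refine (Measurable.add ?_ ?_).add (hW.mul (hf.measurable.nnnorm.coe_nnreal_ennreal.pow_const _))
  · refine Finset.measurable_sum _ fun i _ => Finset.measurable_sum _ fun k _ => ?_
    exact ((measurable_fderiv_apply_const_with_param ℝ hX
      (Pi.single i (EuclideanSpace.single k (1 : ℝ)))).comp
        measurable_swap).nnnorm.coe_nnreal_ennreal.pow_const _
  · refine Finset.measurable_sum _ fun i _ => Finset.measurable_sum _ fun k _ => ?_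
    exact (measurable_fderiv_apply_const_with_param ℝ hY
      (Pi.single i (EuclideanSpace.single k (1 : ℝ)))).nnnorm.coe_nnreal_ennreal.pow_const _

/-! #### Slices of a `C¹` function of two copies -/

/-- The `X`-slice `X ↦ Θ (X, Y)` of a `Cⁿ` function is `Cⁿ`. [folklore] -/
theorem contDiff_slice_fst {Θ : Config M × Config M → ℂ} {m : WithTop ℕ∞} (hΘ : ContDiff ℝ m Θ)
    (Z : Config M × Config M) : ContDiff ℝ m (fun X => Θ (X, Z.2)) :=
  hΘ.comp (contDiff_prodMk_left Z.2)

/-- The `Y`-slice `Y ↦ Θ (X, Y)` of a `Cⁿ` function is `Cⁿ`. [folklore] -/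
theorem contDiff_slice_snd {Θ : Config M × Config M → ℂ} {m : WithTop ℕ∞} (hΘ : ContDiff ℝ m Θ)
    (Z : Config M × Config M) : ContDiff ℝ m (fun Y => Θ (Z.1, Y)) :=
  hΘ.comp (contDiff_prodMk_right Z.1)

/-- The `X`-slice of a `C¹` function is differentiable. [folklore] -/
theorem differentiableAt_slice_fst {Θ : Config M × Config M → ℂ} (hΘ : ContDiff ℝ 1 Θ)
    (Z : Config M × Config M) : DifferentiableAt ℝ (fun X => Θ (X, Z.2)) Z.1 :=
  (contDiff_slice_fst hΘ Z).differentiable one_ne_zero _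

/-- The `Y`-slice of a `C¹` function is differentiable. [folklore] -/
theorem differentiableAt_slice_snd {Θ : Config M × Config M → ℂ} (hΘ : ContDiff ℝ 1 Θ)
    (Z : Config M × Config M) : DifferentiableAt ℝ (fun Y => Θ (Z.1, Y)) Z.2 :=
  (contDiff_slice_snd hΘ Z).differentiable one_ne_zero _

/-! #### The parallelogram law and scaling for the quadratic form -/

/-- Bookkeeping for the parallelogram law of the three-term energy density. [folklore] -/
private theorem par_comb {ap am a a' bp bm b b' cp cm c c' w : ℝ≥0∞}
    (h1 : ap + am = 2 * (a + a')) (h2 : bp + bm = 2 * (b + b')) (h3 : cp + cm = 2 * (c + c')) :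
    ap + bp + w * cp + (am + bm + w * cm) = 2 * (a + b + w * c + (a' + b' + w * c')) := by
  calc ap + bp + w * cp + (am + bm + w * cm) = (ap + am) + (bp + bm) + w * (cp + cm) := by ring
    _ = 2 * (a + b + w * c + (a' + b' + w * c')) := by rw [h1, h2, h3]; ring

/-- **Parallelogram law for the half-swapped form**: `q(Θ+Φ) + q(Θ-Φ) = 2 (q Θ + q Φ)` for `C¹`
`Θ, Φ` (here `q Θ = ∫ (|∇_X Θ|² + |∇_Y Θ|² + W |Θ|²) dμ`, given through `hE`). [folklore] -/
theorem form_add_add_sub (μ : Measure (Config M × Config M)) {W : Config M × Config M → ℝ≥0∞}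
    (hW : Measurable W) (E : (Config M × Config M → ℂ) → ℝ≥0∞)
    (hE : ∀ Θ, E Θ = ∫⁻ Z, (kineticDensity (fun X => Θ (X, Z.2)) Z.1 +
      kineticDensity (fun Y => Θ (Z.1, Y)) Z.2 + W Z * ((‖Θ Z‖₊ : ℝ≥0∞)) ^ 2) ∂μ)
    {Θ Φ : Config M × Config M → ℂ} (hΘ : ContDiff ℝ 1 Θ) (hΦ : ContDiff ℝ 1 Φ) :
    E (fun Z => Θ Z + Φ Z) + E (fun Z => Θ Z - Φ Z) = 2 * (E Θ + E Φ) := by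
  simp only [hE]
  rw [← lintegral_add_left (measurable_integrand hW (hΘ.continuous.fun_add hΦ.continuous)),
    ← lintegral_add_left (measurable_integrand hW hΘ.continuous),
    ← lintegral_const_mul _ ((measurable_integrand hW hΘ.continuous).fun_add
      (measurable_integrand hW hΦ.continuous))]
  refine lintegral_congr fun Z => ?_
  exact par_comb
    (kineticDensity_fun_add_add_sub ((contDiff_slice_fst hΘ Z).differentiable one_ne_zero)
      ((contDiff_slice_fst hΦ Z).differentiable one_ne_zero) Z.1)
    (kineticDensity_fun_add_add_sub ((contDiff_slice_snd hΘ Z).differentiable one_ne_zero)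
      ((contDiff_slice_snd hΦ Z).differentiable one_ne_zero) Z.2)
    (ennreal_sq_nnnorm_add_add_sub (Θ Z) (Φ Z))

/-- Parallelogram law for the `L²` norms: `‖Θ+Φ‖² + ‖Θ-Φ‖² = 2 (‖Θ‖² + ‖Φ‖²)`. [folklore] -/
theorem lintegral_nnnorm_add_sub (μ : Measure (Config M × Config M))
    {Θ Φ : Config M × Config M → ℂ} (hΘ : Continuous Θ) (hΦ : Continuous Φ) :
    ∫⁻ Z, ((‖Θ Z + Φ Z‖₊ : ℝ≥0∞)) ^ 2 ∂μ + ∫⁻ Z, ((‖Θ Z - Φ Z‖₊ : ℝ≥0∞)) ^ 2 ∂μ =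
      2 * (∫⁻ Z, ((‖Θ Z‖₊ : ℝ≥0∞)) ^ 2 ∂μ + ∫⁻ Z, ((‖Φ Z‖₊ : ℝ≥0∞)) ^ 2 ∂μ) := by
  rw [← lintegral_add_left ((hΘ.fun_add hΦ).measurable.nnnorm.coe_nnreal_ennreal.pow_const _),
    ← lintegral_add_left (hΘ.measurable.nnnorm.coe_nnreal_ennreal.pow_const _),
    ← lintegral_const_mul _ ((hΘ.measurable.nnnorm.coe_nnreal_ennreal.pow_const _).fun_add
      (hΦ.measurable.nnnorm.coe_nnreal_ennreal.pow_const _))]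
  exact lintegral_congr fun Z => ennreal_sq_nnnorm_add_add_sub (Θ Z) (Φ Z)

/-- **Scaling**: `q(c Θ) = c² q(Θ)` for real `c ≥ 0`. [folklore] -/
theorem form_const_mul (μ : Measure (Config M × Config M)) {W : Config M × Config M → ℝ≥0∞}
    (E : (Config M × Config M → ℂ) → ℝ≥0∞)
    (hE : ∀ Θ, E Θ = ∫⁻ Z, (kineticDensity (fun X => Θ (X, Z.2)) Z.1 +
      kineticDensity (fun Y => Θ (Z.1, Y)) Z.2 + W Z * ((‖Θ Z‖₊ : ℝ≥0∞)) ^ 2) ∂μ)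
    {Θ : Config M × Config M → ℂ} (hΘ : ContDiff ℝ 1 Θ) (c : ℝ) (hc : 0 ≤ c) :
    E (fun Z => (c : ℂ) * Θ Z) = ENNReal.ofReal (c ^ 2) * E Θ := by
  simp only [hE]
  rw [← lintegral_const_mul' _ _ ENNReal.ofReal_ne_top]
  refine lintegral_congr fun Z => ?_
  rw [kineticDensity_const_mul (contDiff_slice_fst hΘ Z) c hc,
    kineticDensity_const_mul (contDiff_slice_snd hΘ Z) c hc, ennorm_real_mul_sq c hc]
  ring

/-! #### The regularised modulus `√(ε² + |g|²) − ε` of ONE function -/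

/-- `|√(ε² + |w|²) − ε|² ≤ |w|²` (`ε > 0`). [folklore] -/
theorem nnnorm_sqrtReg_sq_le (w : ℂ) {ε : ℝ} (hε : 0 < ε) :
    ((‖((Real.sqrt (ε ^ 2 + ‖w‖ ^ 2) - ε : ℝ) : ℂ)‖₊ : ℝ≥0∞)) ^ 2 ≤ ((‖w‖₊ : ℝ≥0∞)) ^ 2 := by
  rw [Complex.nnnorm_real, coe_nnnorm_pow_two_eq_ofReal, Real.norm_eq_abs, sq_abs,
    coe_nnnorm_pow_two_eq_ofReal]
  exact ENNReal.ofReal_le_ofReal (sqrtReg_sq_le hε.le (sq_nonneg _))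

/-- `√(ε² + |g|²) − ε` is `Cⁿ` (as a complex-valued function) when `g` is, for `ε > 0`.
[folklore] -/
theorem contDiff_ofReal_sqrtReg {E' : Type*} [NormedAddCommGroup E'] [NormedSpace ℝ E']
    {g : E' → ℂ} {m : WithTop ℕ∞} (hg : ContDiff ℝ m g) {ε : ℝ} (hε : 0 < ε) :
    ContDiff ℝ m (fun y => ((Real.sqrt (ε ^ 2 + ‖g y‖ ^ 2) - ε : ℝ) : ℂ)) := by
  have h1 : ContDiff ℝ m fun y => ε ^ 2 + ‖g y‖ ^ 2 := contDiff_const.add (hg.norm_sq ℝ)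
  exact Complex.ofRealCLM.contDiff.comp
    ((h1.sqrt fun y => ne_of_gt (by positivity)).sub contDiff_const)

/-- **Diamagnetic inequality for one function**: `‖D(√(ε² + |φ|²) − ε)(x) u‖² ≤ ‖D φ(x) u‖²`
(the one-element case of the convexity inequality for gradients,
`nnnorm_fderiv_ofReal_sqrtReg_sq_le`). [cite: LiebLoss2001, Thm. 7.8] -/
theorem nnnorm_fderiv_ofReal_sqrtReg_one_sq_le {E' : Type*} [NormedAddCommGroup E']
    [NormedSpace ℝ E'] {φ : E' → ℂ} {x : E'} (hφ : DifferentiableAt ℝ φ x) {ε : ℝ} (hε : 0 < ε)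
    (u : E') :
    ((‖fderiv ℝ (fun y => ((Real.sqrt (ε ^ 2 + ‖φ y‖ ^ 2) - ε : ℝ) : ℂ)) x u‖₊ : ℝ≥0∞)) ^ 2 ≤
      ((‖fderiv ℝ φ x u‖₊ : ℝ≥0∞)) ^ 2 := by
  have h := nnnorm_fderiv_ofReal_sqrtReg_sq_le (fun _ : Unit => φ) (fun _ => hφ) hε u
  simp only [Fintype.sum_unique] at h
  exact h

/-- `|∇(√(ε² + |φ|²) − ε)|² ≤ |∇φ|²` pointwise (kinetic densities on `(ℝ³)^M`).
[cite: LiebLoss2001, Thm. 7.8] -/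
theorem kineticDensity_sqrtReg_le {φ : Config M → ℂ} {X : Config M} (hφ : DifferentiableAt ℝ φ X)
    {ε : ℝ} (hε : 0 < ε) :
    kineticDensity (fun Y => ((Real.sqrt (ε ^ 2 + ‖φ Y‖ ^ 2) - ε : ℝ) : ℂ)) X ≤
      kineticDensity φ X :=
  Finset.sum_le_sum fun _ _ => Finset.sum_le_sum fun _ _ =>
    nnnorm_fderiv_ofReal_sqrtReg_one_sq_le hφ hε _

/-- **The regularised modulus does not increase the half-swapped form**: `q(√(ε²+|g|²) − ε) ≤
q(g)` (slice-wise diamagnetic inequality plus `(√(ε²+|g|²) − ε)² ≤ |g|²`; the weight may be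
infinite). [cite: LiebLoss2001, Thm. 7.8] -/
theorem form_sqrtReg_le (μ : Measure (Config M × Config M)) {W : Config M × Config M → ℝ≥0∞}
    (E : (Config M × Config M → ℂ) → ℝ≥0∞)
    (hE : ∀ Θ, E Θ = ∫⁻ Z, (kineticDensity (fun X => Θ (X, Z.2)) Z.1 +
      kineticDensity (fun Y => Θ (Z.1, Y)) Z.2 + W Z * ((‖Θ Z‖₊ : ℝ≥0∞)) ^ 2) ∂μ)
    {g : Config M × Config M → ℂ} (hg : ContDiff ℝ 1 g) {ε : ℝ} (hε : 0 < ε) :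
    E (fun Z => ((Real.sqrt (ε ^ 2 + ‖g Z‖ ^ 2) - ε : ℝ) : ℂ)) ≤ E g := by
  simp only [hE]
  exact lintegral_mono fun Z => add_le_add (add_le_add
      (kineticDensity_sqrtReg_le (differentiableAt_slice_fst hg Z) hε)
      (kineticDensity_sqrtReg_le (differentiableAt_slice_snd hg Z) hε))
    (mul_le_mul_right (nnnorm_sqrtReg_sq_le (g Z) hε) _)

/-- **Removing the regularisation**: `‖√(εₘ²+|g|²) − εₘ‖² → ‖g‖²` in `L¹(μ)` along `εₘ = 1/(m+1)`
(dominated convergence, bound `|g|²`). [folklore] -/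
theorem tendsto_lintegral_nnnorm_sqrtReg_sq (μ : Measure (Config M × Config M))
    {g : Config M × Config M → ℂ} (hg : Continuous g)
    (htop : ∫⁻ Z, ((‖g Z‖₊ : ℝ≥0∞)) ^ 2 ∂μ ≠ ⊤) :
    Tendsto (fun m : ℕ => ∫⁻ Z, ((‖((Real.sqrt ((1 / ((m : ℝ) + 1)) ^ 2 + ‖g Z‖ ^ 2) -
        1 / ((m : ℝ) + 1) : ℝ) : ℂ)‖₊ : ℝ≥0∞)) ^ 2 ∂μ) atTop
      (𝓝 (∫⁻ Z, ((‖g Z‖₊ : ℝ≥0∞)) ^ 2 ∂μ)) := by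
  refine tendsto_lintegral_of_dominated_convergence (fun Z => ((‖g Z‖₊ : ℝ≥0∞)) ^ 2)
    (fun m => ?_) (fun m => ae_of_all _ fun Z => nnnorm_sqrtReg_sq_le (g Z) Nat.one_div_pos_of_nat)
    htop (ae_of_all _ fun Z => ?_)
  · have hc : Continuous fun Z => ((Real.sqrt ((1 / ((m : ℝ) + 1)) ^ 2 + ‖g Z‖ ^ 2) -
        1 / ((m : ℝ) + 1) : ℝ) : ℂ) :=
      Complex.continuous_ofReal.comp
        ((continuous_const.add ((continuous_norm.comp hg).pow 2)).sqrt.sub continuous_const)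
    exact hc.measurable.nnnorm.coe_nnreal_ennreal.pow_const _
  · have h := ENNReal.tendsto_ofReal (tendsto_sqrtReg_sq (sq_nonneg ‖g Z‖))
    rw [← coe_nnnorm_pow_two_eq_ofReal] at h
    refine h.congr fun m => ?_
    rw [Complex.nnnorm_real, coe_nnnorm_pow_two_eq_ofReal, Real.norm_eq_abs, sq_abs]

end Literature.MathematicalPhysics.QuantumManyBody.BoseGas.HalfSwapForm

end
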